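import Summits.Ventures.HodgeRepro.FaceCensusRows8
import Summits.Ventures.HodgeRepro.FaceCensusStructural

/-!
# Proof of the order-6 and order-8 census rows of `RankFourFaceCensus` (seat p4)

Structural clauses (counts of types / places / faces / squares; `SumTwo`, `cornersWF`, `noConjugateCorners` for every
face) come from the generic theorem `CMGaloisType.structural_rows` (EngineCounts / EngineTypes / EngineSquares /
EngineFacesWF), given only the group axioms; the group axioms, the dictionary with the Mathlib group,
`isSquareOrbitReps reps` and the orbit sizes are kernel computations (`decide +kernel`).
-/

namespace Summit.Ventures.HodgeRepro.FaceCensus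

namespace Sextic.Cyclic

/-- **Census row `Sextic.Cyclic`** (type ℤ/6 of order `6`, as printed in `FaceCensusRows8.lean`): the Cayley table is a
group with `conj` a central involution `≠ 1`, identified with `ZMod 6` (`conj ↦ 3`); CM types / places / faces / type squares
`8 / 3 / 48 / 6`; every face satisfies `SumTwo`, has four pairwise distinct CM-type corners and no two complex-conjugate
corners; the type squares form exactly the displayed orbits under the Galois twists (1 orbit of size 6).  Structural clauses by
`structural_rows`, the rest by kernel computation. -/
theorem census : Census := by
  have h1 : Γ.isCMGaloisType = true := by decide +kernel
  have hs := Γ.structural_rows h1 (by norm_num)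
  exact ⟨h1, ⟨by decide +kernel, by decide +kernel, by decide +kernel⟩,
    ⟨hs.1.1.trans (by norm_num), hs.1.2.1.trans (by norm_num), hs.1.2.2.1.trans (by norm_num),
      hs.1.2.2.2.trans (by norm_num)⟩,
    hs.2.1, hs.2.2.1, hs.2.2.2, by decide +kernel, by decide +kernel⟩

end Sextic.Cyclic

namespace Octic.Cyclic

/-- **Census row `Octic.Cyclic`** (type ℤ/8 of order `8`, as printed in `FaceCensusRows8.lean`): the Cayley table is a
group with `conj` a central involution `≠ 1`, identified with `ZMod 8` (`conj ↦ 4`); CM types / places / faces / type squares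
`16 / 4 / 192 / 24`; every face satisfies `SumTwo`, has four pairwise distinct CM-type corners and no two complex-conjugate
corners; the type squares form exactly the displayed orbits under the Galois twists (3 orbits of size 8).  Structural clauses by
`structural_rows`, the rest by kernel computation. -/
theorem census : Census := by
  have h1 : Γ.isCMGaloisType = true := by decide +kernel
  have hs := Γ.structural_rows h1 (by norm_num)
  exact ⟨h1, ⟨by decide +kernel, by decide +kernel, by decide +kernel⟩,
    ⟨hs.1.1.trans (by norm_num), hs.1.2.1.trans (by norm_num), hs.1.2.2.1.trans (by norm_num),
      hs.1.2.2.2.trans (by norm_num)⟩,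
    hs.2.1, hs.2.2.1, hs.2.2.2, by decide +kernel, by decide +kernel⟩

end Octic.Cyclic

namespace Octic.C4C2Square

/-- **Census row `Octic.C4C2Square`** (type ℤ/4 × ℤ/2, c a square of order `8`, as printed in `FaceCensusRows8.lean`): the Cayley table is a
group with `conj` a central involution `≠ 1`, identified with `ZMod 4 × ZMod 2`; CM types / places / faces / type squares
`16 / 4 / 192 / 24`; every face satisfies `SumTwo`, has four pairwise distinct CM-type corners and no two complex-conjugate
corners; the type squares form exactly the displayed orbits under the Galois twists (4 orbits, sizes 8, 4, 8, 4).  Structural clauses by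
`structural_rows`, the rest by kernel computation. -/
theorem census : Census := by
  have h1 : Γ.isCMGaloisType = true := by decide +kernel
  have hs := Γ.structural_rows h1 (by norm_num)
  exact ⟨h1, ⟨by decide +kernel, by decide +kernel, by decide +kernel⟩,
    ⟨hs.1.1.trans (by norm_num), hs.1.2.1.trans (by norm_num), hs.1.2.2.1.trans (by norm_num),
      hs.1.2.2.2.trans (by norm_num)⟩,
    hs.2.1, hs.2.2.1, hs.2.2.2, by decide +kernel, by decide +kernel⟩

end Octic.C4C2Square

namespace Octic.C4C2Nonsquare

/-- **Census row `Octic.C4C2Nonsquare`** (type ℤ/4 × ℤ/2, c not a square of order `8`, as printed in `FaceCensusRows8.lean`): the Cayley table is a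
group with `conj` a central involution `≠ 1`, identified with `ZMod 4 × ZMod 2`; CM types / places / faces / type squares
`16 / 4 / 192 / 24`; every face satisfies `SumTwo`, has four pairwise distinct CM-type corners and no two complex-conjugate
corners; the type squares form exactly the displayed orbits under the Galois twists (4 orbits, sizes 4, 8, 8, 4).  Structural clauses by
`structural_rows`, the rest by kernel computation. -/
theorem census : Census := by
  have h1 : Γ.isCMGaloisType = true := by decide +kernel
  have hs := Γ.structural_rows h1 (by norm_num)
  exact ⟨h1, ⟨by decide +kernel, by decide +kernel, by decide +kernel⟩,
    ⟨hs.1.1.trans (by norm_num), hs.1.2.1.trans (by norm_num), hs.1.2.2.1.trans (by norm_num),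
      hs.1.2.2.2.trans (by norm_num)⟩,
    hs.2.1, hs.2.2.1, hs.2.2.2, by decide +kernel, by decide +kernel⟩

end Octic.C4C2Nonsquare

namespace Octic.Triquadratic

/-- **Census row `Octic.Triquadratic`** (type (ℤ/2)³ of order `8`, as printed in `FaceCensusRows8.lean`): the Cayley table is a
group with `conj` a central involution `≠ 1`, identified with `ZMod 2 × ZMod 2 × ZMod 2`; CM types / places / faces / type squares
`16 / 4 / 192 / 24`; every face satisfies `SumTwo`, has four pairwise distinct CM-type corners and no two complex-conjugate
corners; the type squares form exactly the displayed orbits under the Galois twists (6 orbits of size 4).  Structural clauses by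
`structural_rows`, the rest by kernel computation. -/
theorem census : Census := by
  have h1 : Γ.isCMGaloisType = true := by decide +kernel
  have hs := Γ.structural_rows h1 (by norm_num)
  exact ⟨h1, ⟨by decide +kernel, by decide +kernel, by decide +kernel⟩,
    ⟨hs.1.1.trans (by norm_num), hs.1.2.1.trans (by norm_num), hs.1.2.2.1.trans (by norm_num),
      hs.1.2.2.2.trans (by norm_num)⟩,
    hs.2.1, hs.2.2.1, hs.2.2.2, by decide +kernel, by decide +kernel⟩

end Octic.Triquadratic

namespace Octic.Dihedral

/-- **Census row `Octic.Dihedral`** (type D₄ of order `8`, as printed in `FaceCensusRows8.lean`): the Cayley table is a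
group with `conj` a central involution `≠ 1`, identified with `DihedralGroup 4` (`conj ↦ r 2`); CM types / places / faces / type squares
`16 / 4 / 192 / 24`; every face satisfies `SumTwo`, has four pairwise distinct CM-type corners and no two complex-conjugate
corners; the type squares form exactly the displayed orbits under the Galois twists (5 orbits, sizes 8, 4, 4, 4, 4).  Structural clauses by
`structural_rows`, the rest by kernel computation. -/
theorem census : Census := by
  have h1 : Γ.isCMGaloisType = true := by decide +kernel
  have hs := Γ.structural_rows h1 (by norm_num)
  exact ⟨h1, ⟨by decide +kernel, by decide +kernel, by decide +kernel⟩,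
    ⟨hs.1.1.trans (by norm_num), hs.1.2.1.trans (by norm_num), hs.1.2.2.1.trans (by norm_num),
      hs.1.2.2.2.trans (by norm_num)⟩,
    hs.2.1, hs.2.2.1, hs.2.2.2, by decide +kernel, by decide +kernel⟩

end Octic.Dihedral

namespace Octic.Quaternion

/-- **Census row `Octic.Quaternion`** (type Q₈ of order `8`, as printed in `FaceCensusRows8.lean`): the Cayley table is a
group with `conj` a central involution `≠ 1`, identified with `QuaternionGroup 2` (`conj ↦ a 2`); CM types / places / faces / type squares
`16 / 4 / 192 / 24`; every face satisfies `SumTwo`, has four pairwise distinct CM-type corners and no two complex-conjugate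
corners; the type squares form exactly the displayed orbits under the Galois twists (3 orbits of size 8).  Structural clauses by
`structural_rows`, the rest by kernel computation. -/
theorem census : Census := by
  have h1 : Γ.isCMGaloisType = true := by decide +kernel
  have hs := Γ.structural_rows h1 (by norm_num)
  exact ⟨h1, ⟨by decide +kernel, by decide +kernel, by decide +kernel⟩,
    ⟨hs.1.1.trans (by norm_num), hs.1.2.1.trans (by norm_num), hs.1.2.2.1.trans (by norm_num),
      hs.1.2.2.2.trans (by norm_num)⟩,
    hs.2.1, hs.2.2.1, hs.2.2.2, by decide +kernel, by decide +kernel⟩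

end Octic.Quaternion

end Summit.Ventures.HodgeRepro.FaceCensus
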